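import Literature.AnabelianGeometry.EtaleTheta.SettingModelSlice2Original
import HarnessLib

/-!
# (L3′) slice 2, file 12/13 — (G‴)/(G⁗) twist-law rigidity of four-syllable elements; the transversal `T′ = {β_{x−1}^s a^x b^i}` of `U_d` for every `l`

Part of the (L3′) slice-2 chain (abc-iut-L6-t19; FILING SHAPE derived from scratch v5 `Slice2TheoremR2ScratchV5.lean`
551b982286441a66 by the edits E1–E4/D1–D3/H1–H2 of FILING-PLAN-SLICE2.md 9643c7e42a42ad24 and the OPTION-L re-cut of §F v1.19gz (W):
one definitions file + twelve theorem files).  Classical profinite group theory about OUR semi-synthetic `F₂hatT`; the objects and laws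
are those of the one-sentence residual of record (cf. [EtTh] §1, §2 for the role they play there — nothing of [EtTh]/[IUTchII]/[IUTchIII]
in print is asserted; no side on [IUTchIII] Cor. 3.12; MORATORIUM (E): no application to `hext_at_iff_exists_f2hatAut_of_eq`).
-/

noncomputable section

open scoped Pointwise

namespace Literature.AnabelianGeometry.EtaleTheta.SettingModel.Slice2

open Literature.AnabelianGeometry.EtaleTheta.SettingModel
open Literature.AnabelianGeometry.EtaleTheta (ZHatLevel.level ZHatLevel.levelChar)
open Literature.AnabelianGeometry.SemiGraphs (GQp)
open Literature.AnabelianGeometry.AbsoluteAnabelian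
open Literature.AnabelianGeometry.AbsoluteAnabelian.AbsTopII
open _root_.Topology

/-! ## §19 (S8′–S10 of PL3-R2 for EVERY `l`) FOUR-SYLLABLE ELEMENTS, THE TRANSVERSAL
`T′ = {β_{x−1}^s a^x b^i : 0 ≤ x < l, 0 ≤ s < (x,l), 0 ≤ i < l/(x,l)}`, THEOREM R2 AND COROLLARY (L3′) FOR ALL `l`

The Schreier generators of `U_d` with respect to `T′` are: `1`, parallel cusps `ξ_{x,s}^{(±l/(x,l))}`, `A^{±1}`,
and `u_{x,s} · W` / `W′ · u_{x−1,s′}⁻¹` with `W, W′` FOUR-SYLLABLE words of one vertex group `P_x` / `P_{x−1}`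
whose parallel prefixes/suffixes are the parallel cusps of §14′ — all `Ψ′`-fixed.  No hypothesis on `l`. -/

section FourSyllable

variable {p : ℕ} [Fact p.Prime] {l : ℕ+} {U₀ : Subgroup (GQp p)} {m : ℕ+} {f' : F₂hatT} {Ψ : F₂hatT → F₂hatT}

/-- **(G‴) — TWIST-LAW RIGIDITY, abstract form.**  If `v ∈ Û_l` lies in a conjugate vertex group `P_{η i}` and
for every `σ ∈ U‴` the twist moves `v` by `Ψ′`-FIXED factors `θ_σ(v) = C₁ v C₂` with `θ_σ(g₁) = C₁ g₁` for some
fixed `g₁`, then `Ψ′(v) = v` (`h := Ψ′(v) v⁻¹` has `θ(g₁⁻¹ h g₁) = g₁⁻¹ h g₁`, so `g₁⁻¹ h g₁ ∈ a^Ẑ` by Thm R1,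
and `ê(h) = 0`). [cite: MochizukiEtTh2009, §1 p.12] -/
theorem AxisPinned.psi_eq_of_twistLaw (H : AxisPinned p l U₀ m f' Ψ) [U₀.FiniteIndex]
    (v g₁ : F₂hatT) (i : ℤ) (hvU : v ∈ Uhat l)
    (hvP : (aPow (ZHatLevel.eta i))⁻¹ * v * aPow (ZHatLevel.eta i) ∈ DehnTwist.vertGp)
    (hθ : ∀ σ ∈ U3 p l U₀, ∃ C₁ C₂ : F₂hatT, C₁ ∈ Uhat l ∧ C₂ ∈ Uhat l ∧ Ψ C₁ = C₁ ∧ Ψ C₂ = C₂ ∧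
      twist (chi p σ) v = C₁ * v * C₂ ∧ twist (chi p σ) g₁ = C₁ * g₁) : Ψ v = v := by
  haveI := finiteIndex_U3 p l U₀
  set h := Ψ v * v⁻¹ with hh
  have hΨP : (aPow (ZHatLevel.eta i))⁻¹ * Ψ v * aPow (ZHatLevel.eta i) ∈ DehnTwist.vertGp :=
    H.res.conj_psi_mem_vertGp (ZHatLevel.eta i) H.dexact (fun k => H.dElt_fixed k i) hvU hvP
  have hdeg : eHat h = 1 := by
    rw [hh, map_mul, map_inv, eHat_eq_one_of_conj_mem_vertGp hΨP, eHat_eq_one_of_conj_mem_vertGp hvP, inv_one,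
      mul_one]
  have hfix : ∀ σ ∈ U3 p l U₀, twist (chi p σ) (g₁⁻¹ * h * g₁) = g₁⁻¹ * h * g₁ := by
    intro σ hσ
    have hσ0 : σ ∈ U₀ := (Subgroup.mem_inf.mp hσ).1
    obtain ⟨C₁, C₂, hC₁U, hC₂U, hC₁f, hC₂f, hθv, hθ1⟩ := hθ σ hσ
    have hΨθ : Ψ (twist (chi p σ) v) = C₁ * Ψ v * C₂ := by
      rw [hθv, H.res.mul _ (mul_mem hC₁U hvU) _ hC₂U, H.res.mul _ hC₁U _ hvU, hC₁f, hC₂f]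
    rw [H.res.torus σ hσ0 v hvU] at hΨθ
    have hθh : twist (chi p σ) h = C₁ * h * C₁⁻¹ := by
      rw [hh, map_mul, map_inv, hΨθ, hθv]; group
    rw [map_mul, map_mul, map_inv, hθ1, hθh]; group
  obtain ⟨s₀, hs₀⟩ := Slice1.thetaFixedRigidityOn_holds p (U3 p l U₀) (g₁⁻¹ * h * g₁) hfix
  have hs : s₀ = 1 := by
    have := congrArg eHat hs₀
    rw [map_mul, map_mul, map_inv, hdeg, mul_one, inv_mul_cancel] at this
    rw [← aPow, eHat_aPow] at this
    exact this.symm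
  rw [hs, map_one] at hs₀
  have hh1 : h = 1 := by
    have e : h = g₁ * (g₁⁻¹ * h * g₁) * g₁⁻¹ := by group
    rw [e, hs₀, mul_one, mul_inv_cancel]
  rw [hh] at hh1
  exact mul_inv_eq_one.mp hh1

/-- `β_{s₁}^{t₁} β_{s₂}^{t₂} β_{s₃}^{t₃} β_{s₄}^{t₄} ∈ Û_l ↔ Σ s̄ᵢ t̄ᵢ = 0`. [cite: MochizukiEtTh2009, Def 2.5 (i) p.39] -/
theorem betaPow_mul4_mem_Uhat_iff (s₁ t₁ s₂ t₂ s₃ t₃ s₄ t₄ : ZH) :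
    betaPow s₁ t₁ * betaPow s₂ t₂ * betaPow s₃ t₃ * betaPow s₄ t₄ ∈ Uhat l ↔
      Multiplicative.toAdd (ZHatLevel.level l s₁) * Multiplicative.toAdd (ZHatLevel.level l t₁) +
        Multiplicative.toAdd (ZHatLevel.level l s₂) * Multiplicative.toAdd (ZHatLevel.level l t₂) +
        Multiplicative.toAdd (ZHatLevel.level l s₃) * Multiplicative.toAdd (ZHatLevel.level l t₃) +
        Multiplicative.toAdd (ZHatLevel.level l s₄) * Multiplicative.toAdd (ZHatLevel.level l t₄) = 0 := by
  rw [mem_Uhat_iff, map_mul, map_mul, map_mul, hHat_betaPow, hHat_betaPow, hHat_betaPow, hHat_betaPow]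
  simp only [Heis.mul_x, Heis.mul_z, add_zero, zero_mul, true_and]

/-- A product of four elements of `a^{s} Π_v a^{-s}` lies there. [cite: MochizukiAbsTopII2013, Prop 1.3 (ii) p.11] -/
theorem conj_mul4_mem_vertGp {a g₁ g₂ g₃ g₄ : F₂hatT} (h₁ : a⁻¹ * g₁ * a ∈ DehnTwist.vertGp)
    (h₂ : a⁻¹ * g₂ * a ∈ DehnTwist.vertGp) (h₃ : a⁻¹ * g₃ * a ∈ DehnTwist.vertGp)
    (h₄ : a⁻¹ * g₄ * a ∈ DehnTwist.vertGp) : a⁻¹ * (g₁ * g₂ * g₃ * g₄) * a ∈ DehnTwist.vertGp := by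
  have := mul_mem (mul_mem (mul_mem h₁ h₂) h₃) h₄
  rwa [show a⁻¹ * g₁ * a * (a⁻¹ * g₂ * a) * (a⁻¹ * g₃ * a) * (a⁻¹ * g₄ * a) = a⁻¹ * (g₁ * g₂ * g₃ * g₄) * a by
    group] at this

/-- `a^{-x} β_{x+1}^e a^{x} ∈ Π_v`. [cite: MochizukiAbsTopII2013, Prop 1.3 (ii) p.11] -/
theorem conj_betaPow_eta_succ_mem_vertGp (x : ℤ) (e : ZH) :
    (aPow (ZHatLevel.eta x))⁻¹ * betaPow (ZHatLevel.eta (x + 1)) e * aPow (ZHatLevel.eta x) ∈ DehnTwist.vertGp := by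
  rw [eta_succ]; exact conj_betaPow_succ_mem_vertGp _ _

/-- `a^{-(x-1)} β_x^e a^{x-1} ∈ Π_v`. [cite: MochizukiAbsTopII2013, Prop 1.3 (ii) p.11] -/
theorem conj_betaPow_eta_pred_mem_vertGp (x : ℤ) (e : ZH) :
    (aPow (ZHatLevel.eta (x - 1)))⁻¹ * betaPow (ZHatLevel.eta x) e * aPow (ZHatLevel.eta (x - 1)) ∈
      DehnTwist.vertGp := by
  have := conj_betaPow_eta_succ_mem_vertGp (x - 1) e
  rwa [sub_add_cancel] at this

/-- **(G⁗) — FOUR-SYLLABLE ELEMENTS ARE FIXED.**  For `v = β_{j₁}^{e₁} β_{j₂}^{e₂} β_{j₁}^{e₃} β_{j₂}^{e₄} ∈ Û_l`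
in a conjugate vertex group, `θ_σ(v) = C₁ v C₂` with `C₁ = β_{j₁}^{(χ−1)e₁} · (β_{j₁}^{e₁} β_{j₂}^{(χ−1)e₂} β_{j₁}^{−e₁})`
and `C₂ = (β_{j₂}^{−e₄} β_{j₁}^{(χ−1)e₃} β_{j₂}^{e₄}) · β_{j₂}^{(χ−1)e₄}` — axis cusps and PARALLEL cusps; if the
two parallel cusps are `Ψ′`-fixed then `Ψ′(v) = v` by (G‴). [cite: MochizukiEtTh2009, §1 p.12] -/
theorem AxisPinned.psi_fourSyllable (H : AxisPinned p l U₀ m f' Ψ) [U₀.FiniteIndex]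
    (j₁ j₂ : ℤ) (e₁ e₂ e₃ e₄ : ZH) (i : ℤ)
    (hvU : betaPow (ZHatLevel.eta j₁) e₁ * betaPow (ZHatLevel.eta j₂) e₂ * betaPow (ZHatLevel.eta j₁) e₃ *
      betaPow (ZHatLevel.eta j₂) e₄ ∈ Uhat l)
    (hvP : (aPow (ZHatLevel.eta i))⁻¹ * (betaPow (ZHatLevel.eta j₁) e₁ * betaPow (ZHatLevel.eta j₂) e₂ *
      betaPow (ZHatLevel.eta j₁) e₃ * betaPow (ZHatLevel.eta j₂) e₄) * aPow (ZHatLevel.eta i) ∈ DehnTwist.vertGp)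
    (hpar₁ : ∀ σ ∈ torusCong p l,
      Ψ (betaPow (ZHatLevel.eta j₁) e₁ * betaPow (ZHatLevel.eta j₂) (chi p σ e₂ * e₂⁻¹) *
        (betaPow (ZHatLevel.eta j₁) e₁)⁻¹) =
        betaPow (ZHatLevel.eta j₁) e₁ * betaPow (ZHatLevel.eta j₂) (chi p σ e₂ * e₂⁻¹) *
        (betaPow (ZHatLevel.eta j₁) e₁)⁻¹)
    (hpar₂ : ∀ σ ∈ torusCong p l,
      Ψ ((betaPow (ZHatLevel.eta j₂) e₄)⁻¹ * betaPow (ZHatLevel.eta j₁) (chi p σ e₃ * e₃⁻¹) *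
        betaPow (ZHatLevel.eta j₂) e₄) =
        (betaPow (ZHatLevel.eta j₂) e₄)⁻¹ * betaPow (ZHatLevel.eta j₁) (chi p σ e₃ * e₃⁻¹) *
        betaPow (ZHatLevel.eta j₂) e₄) :
    Ψ (betaPow (ZHatLevel.eta j₁) e₁ * betaPow (ZHatLevel.eta j₂) e₂ * betaPow (ZHatLevel.eta j₁) e₃ *
      betaPow (ZHatLevel.eta j₂) e₄) =
      betaPow (ZHatLevel.eta j₁) e₁ * betaPow (ZHatLevel.eta j₂) e₂ * betaPow (ZHatLevel.eta j₁) e₃ *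
      betaPow (ZHatLevel.eta j₂) e₄ := by
  refine H.psi_eq_of_twistLaw _ (betaPow (ZHatLevel.eta j₁) e₁ * betaPow (ZHatLevel.eta j₂) e₂) i hvU hvP
    fun σ hσ => ?_
  have hσl : σ ∈ torusCong p l := (Subgroup.mem_inf.mp hσ).2
  have ha₁U : betaPow (ZHatLevel.eta j₁) (chi p σ e₁ * e₁⁻¹) ∈ Uhat l := betaPow_chi_div_mem_Uhat hσl _ _
  have ha₄U : betaPow (ZHatLevel.eta j₂) (chi p σ e₄ * e₄⁻¹) ∈ Uhat l := betaPow_chi_div_mem_Uhat hσl _ _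
  have hp₁U : betaPow (ZHatLevel.eta j₁) e₁ * betaPow (ZHatLevel.eta j₂) (chi p σ e₂ * e₂⁻¹) *
      (betaPow (ZHatLevel.eta j₁) e₁)⁻¹ ∈ Uhat l :=
    (conj_mem_Uhat_iff_of_x_eq_zero (by rw [hHat_betaPow]) _).2 (betaPow_chi_div_mem_Uhat hσl _ _)
  have hp₂U : (betaPow (ZHatLevel.eta j₂) e₄)⁻¹ * betaPow (ZHatLevel.eta j₁) (chi p σ e₃ * e₃⁻¹) *
      betaPow (ZHatLevel.eta j₂) e₄ ∈ Uhat l := by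
    have := (conj_mem_Uhat_iff_of_x_eq_zero (l := l) (f := (betaPow (ZHatLevel.eta j₂) e₄)⁻¹)
      (by simp [map_inv, Heis.inv_x, hHat_betaPow]) (betaPow (ZHatLevel.eta j₁) (chi p σ e₃ * e₃⁻¹))).2
      (betaPow_chi_div_mem_Uhat hσl _ _)
    rwa [inv_inv] at this
  refine ⟨betaPow (ZHatLevel.eta j₁) (chi p σ e₁ * e₁⁻¹) * (betaPow (ZHatLevel.eta j₁) e₁ *
      betaPow (ZHatLevel.eta j₂) (chi p σ e₂ * e₂⁻¹) * (betaPow (ZHatLevel.eta j₁) e₁)⁻¹),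
    (betaPow (ZHatLevel.eta j₂) e₄)⁻¹ * betaPow (ZHatLevel.eta j₁) (chi p σ e₃ * e₃⁻¹) * betaPow (ZHatLevel.eta j₂) e₄ *
      betaPow (ZHatLevel.eta j₂) (chi p σ e₄ * e₄⁻¹),
    mul_mem ha₁U hp₁U, mul_mem hp₂U ha₄U, ?_, ?_, ?_, ?_⟩
  · rw [H.res.mul _ ha₁U _ hp₁U, H.psi_axis j₁ ha₁U, hpar₁ σ hσl]
  · rw [H.res.mul _ hp₂U _ ha₄U, hpar₂ σ hσl, H.psi_axis j₂ ha₄U]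
  · rw [map_mul, map_mul, map_mul, twist_betaPow_eq_mul, twist_betaPow_eq_mul, twist_betaPow_eq_mul,
      twist_betaPow_eq_mul, betaPow_comm (ZHatLevel.eta j₁) (chi p σ e₃ * e₃⁻¹) e₃,
      betaPow_comm (ZHatLevel.eta j₂) (chi p σ e₄ * e₄⁻¹) e₄]
    group
  · rw [map_mul, twist_betaPow_eq_mul, twist_betaPow_eq_mul]; group

end FourSyllable

/-! ### The transversal `T′` for every `l` -/

section CompositeTransversal

variable {p : ℕ} [Fact p.Prime] {l : ℕ+} {U₀ : Subgroup (GQp p)} {m : ℕ+} {f' : F₂hatT} {Ψ : F₂hatT → F₂hatT}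

/-- `l ∣ x · ε · (l/(x,l))`. [cite: MochizukiEtTh2009, Def 2.5 (i) p.39] -/
theorem dvd_mul_mul_div_gcd (l : ℕ+) (x ε : ℤ) : (l : ℤ) ∣ x * (ε * ((l : ℤ) / (Int.gcd x l : ℤ))) := by
  set d : ℕ := Int.gcd x l with hd
  have hdZ : (d : ℤ) ≠ 0 := by
    have := Int.gcd_pos_of_ne_zero_right x (show (l : ℤ) ≠ 0 by exact_mod_cast l.ne_zero)
    rw [← hd] at this
    exact_mod_cast this.ne'
  obtain ⟨c, hc⟩ : (d : ℤ) ∣ x := Int.gcd_dvd_left x l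
  obtain ⟨e, he⟩ : (d : ℤ) ∣ (l : ℤ) := Int.gcd_dvd_right x l
  rw [he, Int.mul_ediv_cancel_left _ hdZ, hc]
  exact ⟨c * ε, by ring⟩

/-- **Coordinates of the `z`-classes**: for every `y, z ∈ ℤ` there are `0 ≤ s < (y,l)`, `0 ≤ i < l/(y,l)` with
`(y−1)s + y i ≡ z (mod l)` (`y − 1 ≡ −1` is a unit mod `(y,l)`; `y/(y,l)` is a unit mod `l/(y,l)`).
[cite: MochizukiEtTh2009, Def 2.5 (i) p.39] -/
theorem exists_coords (l : ℕ+) (y z : ℤ) : ∃ s i : ℤ, 0 ≤ s ∧ s < (Int.gcd y l : ℤ) ∧ 0 ≤ i ∧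
    i < (l : ℤ) / (Int.gcd y l : ℤ) ∧ (l : ℤ) ∣ (y - 1) * s + y * i - z := by
  have hl0 : (l : ℤ) ≠ 0 := by exact_mod_cast l.ne_zero
  set d : ℕ := Int.gcd y l with hd
  have hd0 : 0 < d := Int.gcd_pos_of_ne_zero_right _ hl0
  have hdZ : (0 : ℤ) < d := by exact_mod_cast hd0
  obtain ⟨c, hc⟩ : (d : ℤ) ∣ y := Int.gcd_dvd_left y l
  obtain ⟨e, he⟩ : (d : ℤ) ∣ (l : ℤ) := Int.gcd_dvd_right y l
  have he0 : 0 < e := pos_of_mul_pos_right (by rw [← he]; exact_mod_cast l.pos) hdZ.le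
  have hyd : y / d = c := by rw [hc, Int.mul_ediv_cancel_left _ hdZ.ne']
  have hld : (l : ℤ) / d = e := by rw [he, Int.mul_ediv_cancel_left _ hdZ.ne']
  have hce : IsCoprime c e := by
    have h3 : Int.gcd (y / d) ((l : ℤ) / d) = 1 := Int.gcd_div_gcd_div_gcd hd0
    rw [hyd, hld] at h3
    exact Int.isCoprime_iff_gcd_eq_one.mpr h3
  obtain ⟨u, v, huv⟩ := hce
  obtain ⟨q, hsq⟩ : ∃ q : ℤ, (-z) % (d : ℤ) = -z - d * q := ⟨(-z) / d, Int.emod_def _ _⟩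
  set w : ℤ := -q - c * (-z - d * q) with hw
  obtain ⟨q', hiq⟩ : ∃ q' : ℤ, (u * w) % e = u * w - e * q' := ⟨(u * w) / e, Int.emod_def _ _⟩
  refine ⟨-z - d * q, u * w - e * q', ?_, ?_, ?_, ?_, -(v * w + c * q'), ?_⟩
  · rw [← hsq]; exact Int.emod_nonneg _ hdZ.ne'
  · rw [← hsq]; exact Int.emod_lt_of_pos _ hdZ
  · rw [← hiq]; exact Int.emod_nonneg _ he0.ne'
  · rw [hld, ← hiq]; exact Int.emod_lt_of_pos _ he0
  · rw [hc, he]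
    linear_combination ((d : ℤ) * w) * huv + (d : ℤ) * hw

/-- [cite: MochizukiEtTh2009, §1 p.12] -/
theorem rep_mem_transT {x s i : ℤ} (h1 : 0 ≤ x) (h2 : x ≤ (l : ℤ) - 1) (h3 : 0 ≤ s) (h4 : s < (Int.gcd x l : ℤ))
    (h5 : 0 ≤ i) (h6 : i < (l : ℤ) / (Int.gcd x l : ℤ)) : rep x s i ∈ transT l :=
  ⟨x, s, i, h1, h2, h3, h4, h5, h6, rfl⟩

/-- `(0, l) = l`. [cite: MochizukiEtTh2009, Def 2.5 (i) p.39] -/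
theorem gcd_zero_pnat (l : ℕ+) : (Int.gcd 0 (l : ℤ) : ℤ) = l := by simp

/-- `(l − 1, l) = 1`. [cite: MochizukiEtTh2009, Def 2.5 (i) p.39] -/
theorem gcd_pred_pnat (l : ℕ+) : (Int.gcd ((l : ℤ) - 1) (l : ℤ) : ℤ) = 1 := by
  have : Int.gcd ((l : ℤ) - 1) (l : ℤ) = 1 := Int.isCoprime_iff_gcd_eq_one.mp ⟨-1, 1, by ring⟩
  rw [this, Nat.cast_one]

/-- `1 = rep 0 0 0 ∈ T′`. [cite: MochizukiEtTh2009, §1 p.12] -/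
theorem one_mem_transT : (1 : F₂) ∈ transT l := by
  refine ⟨0, 0, 0, le_rfl, by have := l.pos; omega, le_rfl, ?_, le_rfl, ?_, ?_⟩
  · rw [gcd_zero_pnat]; exact_mod_cast l.pos
  · rw [gcd_zero_pnat, Int.ediv_self (by exact_mod_cast l.ne_zero)]; exact zero_lt_one
  · simp only [rep, zpow_zero, mul_one, zero_sub, sub_zero]; group

/-- `b^{η n} = b^n` (letters spelled out). [cite: MochizukiEtTh2009, §1 p.12] -/
theorem bPow_eta' (n : ℤ) : bPow (ZHatLevel.eta n) = eta (FreeGroup.of 1) ^ n := bPow_eta n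

/-- `η(rep) = β_{x−1}^{s} · a^x b^i`. [cite: MochizukiEtTh2009, §1 p.12] -/
theorem eta_rep (x s i : ℤ) : eta (rep x s i) =
    betaPow (ZHatLevel.eta (x - 1)) (ZHatLevel.eta s) * (aPow (ZHatLevel.eta x) * bPow (ZHatLevel.eta i)) := by
  rw [betaPow_eta_eta, aPow_eta', bPow_eta']
  simp only [rep, map_mul, map_zpow]
  group

/-- `T′ ∩ U_d = {1}`. [cite: MochizukiEtTh2009, Def 2.5 (i) p.39] -/
theorem eq_one_of_mem_transT_of_mem_Ud {t : F₂} (ht : t ∈ transT l) (hU : t ∈ Ud l) : t = 1 := by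
  obtain ⟨x, s, i, h1, h2, h3, h4, h5, h6, rfl⟩ := ht
  rw [mem_Ud_iff, eta_rep, mem_Uhat_iff] at hU
  obtain ⟨hX, hZ⟩ := hU
  have hx : x = 0 := by
    rw [map_mul, map_mul, Heis.mul_x, Heis.mul_x, hHat_betaPow, hHat_aPow, hHat_bPow] at hX
    simp only [add_zero, zero_add, toAdd_level_eta] at hX
    rw [ZMod.intCast_zmod_eq_zero_iff_dvd] at hX
    rcases eq_or_ne x 0 with h | h
    · exact h
    · have := Int.le_of_dvd (by omega) hX; omega
  subst hx
  rw [gcd_zero_pnat, Int.ediv_self (by exact_mod_cast l.ne_zero)] at h6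
  have hi : i = 0 := by omega
  subst hi
  have h01 : ZHatLevel.eta 0 = (1 : ZH) := by rw [ZHatLevel.eta_eq_zpow, zpow_zero]
  rw [h01, aPow_one, map_one, mul_one, mul_one, hHat_betaPow] at hZ
  simp only [toAdd_level_eta] at hZ
  push_cast at hZ
  have hs' : ((s : ℤ) : ZMod l) = 0 := by linear_combination -hZ
  rw [ZMod.intCast_zmod_eq_zero_iff_dvd] at hs'
  rw [gcd_zero_pnat] at h4
  have hs : s = 0 := by
    rcases eq_or_ne s 0 with h | h
    · exact h
    · have := Int.le_of_dvd (by omega) hs'; omega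
  subst hs
  simp only [rep, zpow_zero, mul_one, zero_sub, sub_zero]; group

/-- `u_{x, η s}` as a word. [cite: MochizukiEtTh2009, §1 p.12] -/
theorem uElt_eta' (x s : ℤ) : uElt x (ZHatLevel.eta s) =
    eta (FreeGroup.of 0) ^ (x - 1) * eta (FreeGroup.of 1) ^ s * eta (FreeGroup.of 0) ^ (-(x - 1)) *
    (eta (FreeGroup.of 0) ^ x * eta (FreeGroup.of 1) ^ (-(2 * s)) * eta (FreeGroup.of 0) ^ (-x)) *
    (eta (FreeGroup.of 0) ^ (x + 1) * eta (FreeGroup.of 1) ^ s * eta (FreeGroup.of 0) ^ (-(x + 1))) := by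
  rw [uElt, eta_inv, eta_mul_eta, show -s + -s = -(2 * s) by ring, betaPow_eta_eta, betaPow_eta_eta,
    betaPow_eta_eta]

end CompositeTransversal

end Literature.AnabelianGeometry.EtaleTheta.SettingModel.Slice2

end
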